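import Summits.CriticalPhenomena.PercolationContinuityZ3.Theorems.PercNearOneGluingNoHeavyLowerTailIncStarBranchLemmaStep
import HarnessLib

/-!
# The two-target branch lemma `Θ′ ≥ 0`, II: the same-branch bridge step

Support file for the Sahi programme (`--supports stmt-CriticalPhenomena-4575`, prover prim-sahi-p2 gen 19).  No definitions, no named
facts, no sorries; standard axioms.  Memo `prim-sahi-p2/PROOF-E3.md` (29l)–(29m); `Θ′` as in `…IncStarThetaDiffBranch`.
Both targets `b, c` lie (with `x₁`) in the near side `L ∌ s` of the environment bridge `e₁ = s(x₁, v)`.  Conditioning on `e₁`: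
`Θ′(w; v; b, c) = pA′·{Θ′(w[e₁↦0]; x₁; b, c) + (1−p)D₁bD₁c}` (`IncStar.theta_sameBranch_real`, by `ring`), so the induction hypothesis at the
port `x₁` gives `Θ′ ≥ 0`.  Exact check of the identity: gen19 `theta_ident.py`, 120/120.
-/


noncomputable section

namespace Summit.CriticalPhenomena.PercolationContinuityZ3.Theorems

namespace IncStar

open MeasureTheory Set Literature.Probability.Percolation Literature.Probability.LatticeModels EdgeInduction
open scoped Classical

variable {n : ℕ}

/-- **Arithmetic of the same-branch bridge step of `Θ′`.** [this work] -/
theorem theta_sameBranch_real (p A' Db Dc Dbc Xb Xc mb mc : ℝ) (hp0 : 0 ≤ p) (hp1 : p ≤ 1) (hA' : 0 ≤ A') (hDb : 0 ≤ Db) (hDc : 0 ≤ Dc)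
    (IH : 0 ≤ Xb + Xc + Dbc - 1 / 2 * (Db * mc + Dc * mb) - Db * Dc) :
    0 ≤ ((1 - p) * 0 + p * (Xb * A'))
        + ((1 - p) * 0 + p * (Xc * A')) + ((1 - p) * 0 + p * (Dbc * A'))
        - 1 / 2 * (((1 - p) * 0 + p * (Db * A')) * ((1 - p) * mc + p * (mc + Dc * (1 - A')))
            + ((1 - p) * 0 + p * (Dc * A')) * ((1 - p) * mb + p * (mb + Db * (1 - A'))))
        - ((1 - p) * 0 + p * (Db * A')) * ((1 - p) * 0 + p * (Dc * A')) := by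
  have key : ((1 - p) * 0 + p * (Xb * A'))
        + ((1 - p) * 0 + p * (Xc * A')) + ((1 - p) * 0 + p * (Dbc * A'))
        - 1 / 2 * (((1 - p) * 0 + p * (Db * A')) * ((1 - p) * mc + p * (mc + Dc * (1 - A')))
            + ((1 - p) * 0 + p * (Dc * A')) * ((1 - p) * mb + p * (mb + Db * (1 - A'))))
        - ((1 - p) * 0 + p * (Db * A')) * ((1 - p) * 0 + p * (Dc * A'))
      = p * A' * ((Xb + Xc + Dbc - 1 / 2 * (Db * mc + Dc * mb) - Db * Dc) + (1 - p) * (Db * Dc)) := by ring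
  rw [key]
  exact mul_nonneg (mul_nonneg hp0 hA') (add_nonneg IH (mul_nonneg (by linarith) (mul_nonneg hDb hDc)))

/-- **`Θ′`, the same-branch bridge step.** [this work] -/
theorem theta_bridge_step_sameBranch (w : Sym2 (Fin n) → unitInterval) (L : Set (Fin n)) {s x₁ v b c : Fin n}
    (hsL : s ∉ L) (hxL : x₁ ∈ L) (hvL : v ∉ L) (hbL : b ∈ L) (hcL : c ∈ L)
    (hcross : ∀ x y : Fin n, x ∈ L → y ∉ L → y ≠ s → s(x, y) ≠ s(x₁, v) → w s(x, y) = 0)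
    (IH : 0 ≤ (prodBernoulli (Function.update w s(x₁, v) 0)).real ((openConn b x₁ \ openConn s x₁) ∩ openConn s c)
        + (prodBernoulli (Function.update w s(x₁, v) 0)).real ((openConn c x₁ \ openConn s x₁) ∩ openConn s b) + (prodBernoulli (Function.update w s(x₁, v) 0)).real ((openConn b x₁ ∩ openConn c x₁) \ openConn s x₁)
        - 1 / 2 * ((prodBernoulli (Function.update w s(x₁, v) 0)).real (openConn b x₁ \ openConn s x₁) * (prodBernoulli (Function.update w s(x₁, v) 0)).real (openConn s c)
            + (prodBernoulli (Function.update w s(x₁, v) 0)).real (openConn c x₁ \ openConn s x₁) * (prodBernoulli (Function.update w s(x₁, v) 0)).real (openConn s b))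
        - (prodBernoulli (Function.update w s(x₁, v) 0)).real (openConn b x₁ \ openConn s x₁) * (prodBernoulli (Function.update w s(x₁, v) 0)).real (openConn c x₁ \ openConn s x₁)) :
    0 ≤ (prodBernoulli w).real ((openConn b v \ openConn s v) ∩ openConn s c)
        + (prodBernoulli w).real ((openConn c v \ openConn s v) ∩ openConn s b) + (prodBernoulli w).real ((openConn b v ∩ openConn c v) \ openConn s v)
        - 1 / 2 * ((prodBernoulli w).real (openConn b v \ openConn s v) * (prodBernoulli w).real (openConn s c)
            + (prodBernoulli w).real (openConn c v \ openConn s v) * (prodBernoulli w).real (openConn s b))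
        - (prodBernoulli w).real (openConn b v \ openConn s v) * (prodBernoulli w).real (openConn c v \ openConn s v) := by
  -- names
  set e : Sym2 (Fin n) := s(x₁, v)
  set w0 := Function.update w e 0 with hw0
  set w1 := Function.update w e 1
  have hs1 : s ∈ insert s L := Set.mem_insert s L
  have hx1 : x₁ ∈ insert s L := Set.mem_insert_of_mem s hxL
  have hb1 : b ∈ insert s L := Set.mem_insert_of_mem s hbL
  have hc1 : c ∈ insert s L := Set.mem_insert_of_mem s hcL
  -- near events and the far event
  set S : Set (BondConfig (Fin n)) := openConnIn (insert s L) s x₁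
  set Bn : Set (BondConfig (Fin n)) := openConnIn (insert s L) s b
  set Cn : Set (BondConfig (Fin n)) := openConnIn (insert s L) s c
  set Fb : Set (BondConfig (Fin n)) := openConnIn (insert s L) b x₁
  set Fc : Set (BondConfig (Fin n)) := openConnIn (insert s L) c x₁
  set W' : Set (BondConfig (Fin n)) := openConnIn Lᶜ s v
  -- (0) the bridge hypothesis under `w0`, the almost-sure set, independence
  have hw0cross : ∀ x y : Fin n, x ∈ L → y ∉ L → y ≠ s → w0 s(x, y) = 0 := by
    intro x y hx hy hys
    by_cases hxy : s(x, y) = e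
    · rw [hxy, hw0, Function.update_self]
    · rw [hw0, Function.update_of_ne hxy]; exact hcross x y hx hy hys hxy
  set G : Set (BondConfig (Fin n)) := {ω | ∀ e', w0 e' = 0 → e' ∉ ω}
  have hG1 : (prodBernoulli w0).real G = 1 := real_sureClosed w0
  have hωG : ∀ ω ∈ G, ∀ x y : Fin n, x ∈ L → y ∉ L → y ≠ s → s(x, y) ∉ ω :=
    fun ω hω x y hx hy hys => hω _ (hw0cross x y hx hy hys)
  have hm : ∀ X : Set (BondConfig (Fin n)), MeasurableSet X := fun _ => MeasurableSet.of_discrete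
  have hdiff : ∀ {A B : Set (BondConfig (Fin n))} {K' : Set (Sym2 (Fin n))},
      DeterminedBy A K' → DeterminedBy B K' → DeterminedBy (A \ B) K' := by
    intro A B K' hA hB
    rw [determinedBy_iff] at hA hB ⊢
    intro ω ω' h
    rw [Set.mem_sdiff, Set.mem_sdiff, hA ω ω' h, hB ω ω' h]
  have hdn : ∀ x y : Fin n, DeterminedBy (openConnIn (insert s L) x y : Set (BondConfig (Fin n)))
      {z : Sym2 (Fin n) | ¬ z.IsDiag ∧ ∀ x ∈ z, x ∈ insert s L} := fun x y => IncStarCutVertex.determinedBy_openConnIn_offDiag _ x y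
  have hdW'c : DeterminedBy (Set.univ \ W') {z : Sym2 (Fin n) | ¬ z.IsDiag ∧ ∀ x ∈ z, x ∈ Lᶜ} :=
    hdiff (determinedBy_univ _) (IncStarCutVertex.determinedBy_openConnIn_offDiag _ s v)
  have indep : ∀ {A B : Set (BondConfig (Fin n))}, DeterminedBy A {z : Sym2 (Fin n) | ¬ z.IsDiag ∧ ∀ x ∈ z, x ∈ insert s L} →
      DeterminedBy B {z : Sym2 (Fin n) | ¬ z.IsDiag ∧ ∀ x ∈ z, x ∈ Lᶜ} →
      (prodBernoulli w0).real (A ∩ B) = (prodBernoulli w0).real A * (prodBernoulli w0).real B :=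
    fun hA hB => indep_blocks w0 L s hA hB
  -- (1) dictionary on the sure set
  have c_sv : ∀ ω ∈ G, (ω ∈ openConn s v ↔ ω ∈ W') := fun ω hω => by
    rw [bridge_conn_lr L hsL (hωG ω hω) hs1 hvL]
    exact ⟨fun h => h.2, fun h => ⟨⟨hs1, hs1, SimpleGraph.Reachable.refl _⟩, h⟩⟩
  have c_sb : ∀ ω ∈ G, (ω ∈ openConn s b ↔ ω ∈ Bn) := fun ω hω => bridge_conn_ll L hsL (hωG ω hω) hs1 hb1
  have c_sc : ∀ ω ∈ G, (ω ∈ openConn s c ↔ ω ∈ Cn) := fun ω hω => bridge_conn_ll L hsL (hωG ω hω) hs1 hc1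
  have c_bv : ∀ ω ∈ G, (ω ∈ openConn b v ↔ ω ∈ Bn ∧ ω ∈ W') := fun ω hω => by
    rw [bridge_conn_lr L hsL (hωG ω hω) hb1 hvL]
    exact ⟨fun h => ⟨openConnIn_symm' h.1, h.2⟩, fun h => ⟨openConnIn_symm' h.1, h.2⟩⟩
  have c_cv : ∀ ω ∈ G, (ω ∈ openConn c v ↔ ω ∈ Cn ∧ ω ∈ W') := fun ω hω => by
    rw [bridge_conn_lr L hsL (hωG ω hω) hc1 hvL]
    exact ⟨fun h => ⟨openConnIn_symm' h.1, h.2⟩, fun h => ⟨openConnIn_symm' h.1, h.2⟩⟩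
  have c_bx : ∀ ω ∈ G, (ω ∈ openConn b x₁ ↔ ω ∈ Fb) := fun ω hω => bridge_conn_ll L hsL (hωG ω hω) hb1 hx1
  have c_cx : ∀ ω ∈ G, (ω ∈ openConn c x₁ ↔ ω ∈ Fc) := fun ω hω => bridge_conn_ll L hsL (hωG ω hω) hc1 hx1
  have c_xb : ∀ ω ∈ G, (ω ∈ openConn x₁ b ↔ ω ∈ Fb) := fun ω hω => by
    rw [bridge_conn_ll L hsL (hωG ω hω) hx1 hb1]; exact ⟨fun h => openConnIn_symm' h, fun h => openConnIn_symm' h⟩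
  have c_xc : ∀ ω ∈ G, (ω ∈ openConn x₁ c ↔ ω ∈ Fc) := fun ω hω => by
    rw [bridge_conn_ll L hsL (hωG ω hω) hx1 hc1]; exact ⟨fun h => openConnIn_symm' h, fun h => openConnIn_symm' h⟩
  have c_sx : ∀ ω ∈ G, (ω ∈ openConn s x₁ ↔ ω ∈ S) := fun ω hω => bridge_conn_ll L hsL (hωG ω hω) hs1 hx1
  have c_xs : ∀ ω ∈ G, (ω ∈ openConn x₁ s ↔ ω ∈ S) := fun ω hω => by
    rw [bridge_conn_ll L hsL (hωG ω hω) hx1 hs1]; exact ⟨fun h => openConnIn_symm' h, fun h => openConnIn_symm' h⟩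
  -- (2) lifted events
  have l_sv : ∀ ω ∈ G, (insert e ω ∈ openConn s v ↔ ω ∈ W' ∨ ω ∈ S) := fun ω hω => by
    rw [bridge_lift_far L hsL hxL hvL hvL (hωG ω hω)]
    have hvv : ω ∈ openConnIn Lᶜ v v := ⟨hvL, hvL, SimpleGraph.Reachable.refl _⟩
    exact ⟨fun h => h.imp id fun h' => h'.1, fun h => h.imp id fun h' => ⟨h', hvv⟩⟩
  have l_sb : ∀ ω ∈ G, (insert e ω ∈ openConn s b ↔ ω ∈ Bn ∨ (ω ∈ W' ∧ ω ∈ Fb)) := fun ω hω => by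
    rw [bridge_lift_near L hsL hxL hvL hbL (hωG ω hω)]
    exact ⟨fun h => h.imp id fun h' => ⟨h'.1, openConnIn_symm' h'.2⟩, fun h => h.imp id fun h' => ⟨h'.1, openConnIn_symm' h'.2⟩⟩
  have l_sc : ∀ ω ∈ G, (insert e ω ∈ openConn s c ↔ ω ∈ Cn ∨ (ω ∈ W' ∧ ω ∈ Fc)) := fun ω hω => by
    rw [bridge_lift_near L hsL hxL hvL hcL (hωG ω hω)]
    exact ⟨fun h => h.imp id fun h' => ⟨h'.1, openConnIn_symm' h'.2⟩, fun h => h.imp id fun h' => ⟨h'.1, openConnIn_symm' h'.2⟩⟩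
  have l_bv : ∀ ω ∈ G, (insert e ω ∈ openConn b v ↔ (ω ∈ Bn ∧ ω ∈ W') ∨ ω ∈ Fb) := fun ω hω => by
    rw [insert_pair_mem_openConn_iff, c_bv ω hω, c_bx ω hω]
    have hvv : ω ∈ openConn v v := SimpleGraph.Reachable.refl _
    constructor
    · rintro (h | ⟨h1, -⟩)
      · exact Or.inl h
      · exact h1.symm
    · rintro (h | h)
      · exact Or.inl h
      · exact Or.inr ⟨Or.inl h, Or.inr hvv⟩
  have l_cv : ∀ ω ∈ G, (insert e ω ∈ openConn c v ↔ (ω ∈ Cn ∧ ω ∈ W') ∨ ω ∈ Fc) := fun ω hω => by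
    rw [insert_pair_mem_openConn_iff, c_cv ω hω, c_cx ω hω]
    have hvv : ω ∈ openConn v v := SimpleGraph.Reachable.refl _
    constructor
    · rintro (h | ⟨h1, -⟩)
      · exact Or.inl h
      · exact h1.symm
    · rintro (h | h)
      · exact Or.inl h
      · exact Or.inr ⟨Or.inl h, Or.inr hvv⟩
  -- (3) one-bond decomposition and the lift
  have ob : ∀ A : Set (BondConfig (Fin n)),
      (prodBernoulli w).real A = (1 - (w e : ℝ)) * (prodBernoulli w0).real A + (w e : ℝ) * (prodBernoulli w1).real A := by
    intro A
    have hA : DeterminedBy A (↑(Finset.univ : Finset (Sym2 (Fin n))) : Set (Sym2 (Fin n))) := by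
      rw [determinedBy_iff]
      intro ω ω' h
      rw [Finset.coe_univ, Set.inter_univ, Set.inter_univ] at h
      rw [h]
    exact prodBernoulli_real_oneBond hA w (Finset.mem_univ e)
  have lift : ∀ A : Set (BondConfig (Fin n)),
      (prodBernoulli w1).real A = (prodBernoulli w0).real ((fun ω : BondConfig (Fin n) => insert e ω) ⁻¹' A) :=
    fun A => tieLiftOne_real_one_eq w e A
  have zero_of_empty : ∀ {A : Set (BondConfig (Fin n))}, (∀ ω ∈ G, ω ∉ A) → (prodBernoulli w0).real A = 0 := by
    intro A hA
    have h : (prodBernoulli w0).real A = (prodBernoulli w0).real (∅ : Set (BondConfig (Fin n))) :=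
      real_congr_of_sure hG1 fun ω hω => ⟨fun h => (hA ω hω h).elim, fun h => (Set.notMem_empty _ h).elim⟩
    rw [h, measureReal_empty]
  -- (4) moments under `w0`
  have a0 : (prodBernoulli w0).real (openConn s v)ᶜ = (prodBernoulli w0).real (Set.univ \ W') :=
    real_congr_of_sure hG1 fun ω hω => by
      rw [Set.mem_compl_iff, c_sv ω hω, Set.mem_sdiff]; exact ⟨fun h => ⟨Set.mem_univ _, h⟩, fun h => h.2⟩
  have db0 : (prodBernoulli w0).real (openConn b v \ openConn s v) = 0 :=
    zero_of_empty fun ω hω h => by rw [Set.mem_sdiff, c_bv ω hω, c_sv ω hω] at h; exact h.2 h.1.2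
  have dc0 : (prodBernoulli w0).real (openConn c v \ openConn s v) = 0 :=
    zero_of_empty fun ω hω h => by rw [Set.mem_sdiff, c_cv ω hω, c_sv ω hω] at h; exact h.2 h.1.2
  have dbc0 : (prodBernoulli w0).real ((openConn b v ∩ openConn c v) \ openConn s v) = 0 :=
    zero_of_empty fun ω hω h => by
      rw [Set.mem_sdiff, Set.mem_inter_iff, c_bv ω hω, c_sv ω hω] at h; exact h.2 h.1.1.2
  have xb0 : (prodBernoulli w0).real ((openConn b v \ openConn s v) ∩ openConn s c) = 0 :=
    zero_of_empty fun ω hω h => by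
      rw [Set.mem_inter_iff, Set.mem_sdiff, c_bv ω hω, c_sv ω hω] at h; exact h.1.2 h.1.1.2
  have xc0 : (prodBernoulli w0).real ((openConn c v \ openConn s v) ∩ openConn s b) = 0 :=
    zero_of_empty fun ω hω h => by
      rw [Set.mem_inter_iff, Set.mem_sdiff, c_cv ω hω, c_sv ω hω] at h; exact h.1.2 h.1.1.2
  -- (5) moments under `w1`
  have db1 : (prodBernoulli w1).real (openConn b v \ openConn s v)
      = (prodBernoulli w0).real (Fb \ S) * (prodBernoulli w0).real (Set.univ \ W') := by
    rw [lift, ← indep (hdiff (hdn b x₁) (hdn s x₁)) hdW'c]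
    refine real_congr_of_sure hG1 fun ω hω => ?_
    simp only [Set.preimage_sdiff, Set.mem_sdiff, Set.mem_preimage, l_bv ω hω, l_sv ω hω, Set.mem_inter_iff, Set.mem_univ,
      true_and]
    tauto
  have dc1 : (prodBernoulli w1).real (openConn c v \ openConn s v)
      = (prodBernoulli w0).real (Fc \ S) * (prodBernoulli w0).real (Set.univ \ W') := by
    rw [lift, ← indep (hdiff (hdn c x₁) (hdn s x₁)) hdW'c]
    refine real_congr_of_sure hG1 fun ω hω => ?_
    simp only [Set.preimage_sdiff, Set.mem_sdiff, Set.mem_preimage, l_cv ω hω, l_sv ω hω, Set.mem_inter_iff, Set.mem_univ,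
      true_and]
    tauto
  have dbc1 : (prodBernoulli w1).real ((openConn b v ∩ openConn c v) \ openConn s v)
      = (prodBernoulli w0).real ((Fb ∩ Fc) \ S) * (prodBernoulli w0).real (Set.univ \ W') := by
    rw [lift, ← indep (hdiff ((hdn b x₁).inter (hdn c x₁)) (hdn s x₁)) hdW'c]
    refine real_congr_of_sure hG1 fun ω hω => ?_
    simp only [Set.preimage_sdiff, Set.preimage_inter, Set.mem_sdiff, Set.mem_inter_iff, Set.mem_preimage, l_bv ω hω, l_cv ω hω,
      l_sv ω hω, Set.mem_univ, true_and]
    tauto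
  have xb1 : (prodBernoulli w1).real ((openConn b v \ openConn s v) ∩ openConn s c)
      = (prodBernoulli w0).real ((Fb \ S) ∩ Cn) * (prodBernoulli w0).real (Set.univ \ W') := by
    rw [lift, ← indep ((hdiff (hdn b x₁) (hdn s x₁)).inter (hdn s c)) hdW'c]
    refine real_congr_of_sure hG1 fun ω hω => ?_
    simp only [Set.preimage_sdiff, Set.preimage_inter, Set.mem_sdiff, Set.mem_inter_iff, Set.mem_preimage, l_bv ω hω, l_sc ω hω,
      l_sv ω hω, Set.mem_univ, true_and]
    tauto
  have xc1 : (prodBernoulli w1).real ((openConn c v \ openConn s v) ∩ openConn s b)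
      = (prodBernoulli w0).real ((Fc \ S) ∩ Bn) * (prodBernoulli w0).real (Set.univ \ W') := by
    rw [lift, ← indep ((hdiff (hdn c x₁) (hdn s x₁)).inter (hdn s b)) hdW'c]
    refine real_congr_of_sure hG1 fun ω hω => ?_
    simp only [Set.preimage_sdiff, Set.preimage_inter, Set.mem_sdiff, Set.mem_inter_iff, Set.mem_preimage, l_cv ω hω, l_sb ω hω,
      l_sv ω hω, Set.mem_univ, true_and]
    tauto
  have hW'c : (prodBernoulli w0).real W' = 1 - (prodBernoulli w0).real (Set.univ \ W') := by
    rw [← Set.compl_eq_univ_sdiff, probReal_compl_eq_one_sub (hm _)]; ring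
  have hBFS : ∀ ω, ω ∈ Bn → ω ∈ Fb → ω ∈ S := fun ω hB hF => PlanarDuality.openConnIn_trans hB hF
  have hFSB : ∀ ω, ω ∈ Fb → ω ∈ S → ω ∈ Bn := fun ω hF hS => PlanarDuality.openConnIn_trans hS (openConnIn_symm' hF)
  have hCFS : ∀ ω, ω ∈ Cn → ω ∈ Fc → ω ∈ S := fun ω hC hF => PlanarDuality.openConnIn_trans hC hF
  have hFSC : ∀ ω, ω ∈ Fc → ω ∈ S → ω ∈ Cn := fun ω hF hS => PlanarDuality.openConnIn_trans hS (openConnIn_symm' hF)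
  have mb0 : (prodBernoulli w0).real (openConn s b) = (prodBernoulli w0).real Bn := real_congr_of_sure hG1 c_sb
  have mc0 : (prodBernoulli w0).real (openConn s c) = (prodBernoulli w0).real Cn := real_congr_of_sure hG1 c_sc
  have mb1 : (prodBernoulli w1).real (openConn s b) = (prodBernoulli w0).real Bn + (prodBernoulli w0).real (Fb \ S) * (prodBernoulli w0).real W' := by
    rw [lift, ← indep (hdiff (hdn b x₁) (hdn s x₁)) (IncStarCutVertex.determinedBy_openConnIn_offDiag _ s v), ← measureReal_union ?_ (hm _)]
    · refine real_congr_of_sure hG1 fun ω hω => ?_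
      simp only [Set.mem_preimage, l_sb ω hω, Set.mem_union, Set.mem_inter_iff, Set.mem_sdiff]
      constructor
      · rintro (hB | ⟨hW, hF⟩)
        · exact Or.inl hB
        · by_cases hB : ω ∈ Bn
          · exact Or.inl hB
          · exact Or.inr ⟨⟨hF, fun hS => hB (hFSB ω hF hS)⟩, hW⟩
      · rintro (hB | ⟨⟨hF, -⟩, hW⟩)
        · exact Or.inl hB
        · exact Or.inr ⟨hW, hF⟩
    · exact Set.disjoint_left.2 fun ω hB h2 => h2.1.2 (hBFS ω hB h2.1.1)
  have mc1 : (prodBernoulli w1).real (openConn s c) = (prodBernoulli w0).real Cn + (prodBernoulli w0).real (Fc \ S) * (prodBernoulli w0).real W' := by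
    rw [lift, ← indep (hdiff (hdn c x₁) (hdn s x₁)) (IncStarCutVertex.determinedBy_openConnIn_offDiag _ s v), ← measureReal_union ?_ (hm _)]
    · refine real_congr_of_sure hG1 fun ω hω => ?_
      simp only [Set.mem_preimage, l_sc ω hω, Set.mem_union, Set.mem_inter_iff, Set.mem_sdiff]
      constructor
      · rintro (hC | ⟨hW, hF⟩)
        · exact Or.inl hC
        · by_cases hC : ω ∈ Cn
          · exact Or.inl hC
          · exact Or.inr ⟨⟨hF, fun hS => hC (hFSC ω hF hS)⟩, hW⟩
      · rintro (hC | ⟨⟨hF, -⟩, hW⟩)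
        · exact Or.inl hC
        · exact Or.inr ⟨hW, hF⟩
    · exact Set.disjoint_left.2 fun ω hC h2 => h2.1.2 (hCFS ω hC h2.1.1)
  -- (6) the sub-instance quantities in block form
  have eA₁ : (prodBernoulli w0).real (openConn s x₁)ᶜ = (prodBernoulli w0).real (Set.univ \ S) :=
    real_congr_of_sure hG1 fun ω hω => by
      rw [Set.mem_compl_iff, c_sx ω hω, Set.mem_sdiff]; exact ⟨fun h => ⟨Set.mem_univ _, h⟩, fun h => h.2⟩
  have eDb : (prodBernoulli w0).real (openConn b x₁ \ openConn s x₁) = (prodBernoulli w0).real (Fb \ S) :=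
    real_congr_of_sure hG1 fun ω hω => by rw [Set.mem_sdiff, Set.mem_sdiff, c_bx ω hω, c_sx ω hω]
  have eDc : (prodBernoulli w0).real (openConn c x₁ \ openConn s x₁) = (prodBernoulli w0).real (Fc \ S) :=
    real_congr_of_sure hG1 fun ω hω => by rw [Set.mem_sdiff, Set.mem_sdiff, c_cx ω hω, c_sx ω hω]
  have eDbc : (prodBernoulli w0).real ((openConn b x₁ ∩ openConn c x₁) \ openConn s x₁) = (prodBernoulli w0).real ((Fb ∩ Fc) \ S) :=
    real_congr_of_sure hG1 fun ω hω => by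
      rw [Set.mem_sdiff, Set.mem_sdiff, Set.mem_inter_iff, Set.mem_inter_iff, c_bx ω hω, c_cx ω hω, c_sx ω hω]
  have eXb : (prodBernoulli w0).real ((openConn b x₁ \ openConn s x₁) ∩ openConn s c) = (prodBernoulli w0).real ((Fb \ S) ∩ Cn) :=
    real_congr_of_sure hG1 fun ω hω => by
      rw [Set.mem_inter_iff, Set.mem_inter_iff, Set.mem_sdiff, Set.mem_sdiff, c_bx ω hω, c_sx ω hω, c_sc ω hω]
  have eXc : (prodBernoulli w0).real ((openConn c x₁ \ openConn s x₁) ∩ openConn s b) = (prodBernoulli w0).real ((Fc \ S) ∩ Bn) :=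
    real_congr_of_sure hG1 fun ω hω => by
      rw [Set.mem_inter_iff, Set.mem_inter_iff, Set.mem_sdiff, Set.mem_sdiff, c_cx ω hω, c_sx ω hω, c_sb ω hω]
  have emb : (prodBernoulli w0).real (openConn s b) = (prodBernoulli w0).real Bn := mb0
  have emc : (prodBernoulli w0).real (openConn s c) = (prodBernoulli w0).real Cn := mc0
  -- sign facts
  have hp0 : (0 : ℝ) ≤ w e := (w e).2.1
  have hp1 : (w e : ℝ) ≤ 1 := (w e).2.2
  -- (7) assemble
  have IH' := IH
  rw [eDb, eDc, eDbc, eXb, eXc, emb, emc] at IH'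
  rw [ob (openConn b v \ openConn s v), ob (openConn c v \ openConn s v),
    ob ((openConn b v ∩ openConn c v) \ openConn s v), ob ((openConn b v \ openConn s v) ∩ openConn s c),
    ob ((openConn c v \ openConn s v) ∩ openConn s b), ob (openConn s b), ob (openConn s c),
    db0, db1, dc0, dc1, dbc0, dbc1, xb0, xb1, xc0, xc1, mb0, mb1, mc0, mc1, hW'c]
  have key := theta_sameBranch_real (w e) ((prodBernoulli w0).real (Set.univ \ W'))
    ((prodBernoulli w0).real (Fb \ S)) ((prodBernoulli w0).real (Fc \ S)) ((prodBernoulli w0).real ((Fb ∩ Fc) \ S))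
    ((prodBernoulli w0).real ((Fb \ S) ∩ Cn)) ((prodBernoulli w0).real ((Fc \ S) ∩ Bn))
    ((prodBernoulli w0).real Bn) ((prodBernoulli w0).real Cn)
    hp0 hp1 measureReal_nonneg measureReal_nonneg measureReal_nonneg IH'
  linarith [key]

end IncStar

end Summit.CriticalPhenomena.PercolationContinuityZ3.Theorems
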